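import Literature.NumberTheory.Automorphic.Liu2021.AppendixC.Glue
import Literature.AlgebraicGeometry.Motives.IntegralModelTensorReductionMap
import Literature.AlgebraicGeometry.Motives.IntegralModelReductionMapClopen
import HarnessLib

/-!
# Two geometric points of `X` with the same reduction modulo a smooth proper model lie over a point of `∇X`
# ([Liu2021] Def. 2.1 (1); [SerreTate1968] §1; [Grothendieck1967] 17.5.8 (iii))

Topic `Literature/NumberTheory/Automorphic/Liu2021/AppendixC`, namespace `Literature.NumberTheory.Automorphic.Liu2021.AppendixC`.  ONE THEOREM (no def, no
instance, no notation, no named fact, no `sorry`).  Cell `hodgecm-mathlib` (D-0151), FLOOR 0, programme F0P5a (D9op road 2′, crux item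
stmt-HodgeConjecture-24832): the CLOSER of the support letter **`SmoothProperModelSeparatesNabla`** (`stub_π0` of the line `F0_D9opRoad2`, ED4 §8 step 7,
«reduction separates generic connected components»), with the letter's binders token for token (the letter's extra binders
`[SmoothOfRelativeDimension d X.hom] (_hX : IsProjectiveOver X)` are not needed and not taken).

`Nabla.exists_comp_incl_eq_lift_of_geomReductionMap_eq`: for a number field `F`, a finite place `w`, an `F`-scheme `X` with a `∇`-datum `N`
([Liu2021] Def. 2.1 (1): `∇X ↪ X × X` the smallest open and closed subscheme containing the diagonal), a SMOOTH PROPER model `𝒮` of `X` at `w`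
and two geometric points `p, p' ∈ X(Ω)` (`Ω = \overline{F_w}`) with `red_𝒮 p = red_𝒮 p'`, the pair `(p, p')` is a point of `∇X`.  Proof: `𝒮 ⊗ 𝒮` is a
smooth proper model of `X ⊗ X` (★ `IntegralModel.tensor`, p793511), the reductions of `(p, p)` and `(p, p')` agree (★
`geomReductionMap_tensor_eq_of_components`, p794609), `(p, p) = p ≫ ΔX` factors through the open and closed `∇X`, hence so does `(p, p')` — the
reduction map of a model with integral local rings separates the open-and-closed subschemes of the generic fibre (★
`IntegralModel.exists_comp_eq_of_geomReductionMap_eq_of_isSmoothProper`: smooth over the discrete valuation ring `𝓞_(w)` ⇒ regular ⇒ integral local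
rings, [Grothendieck1967] 17.5.8 (iii), and generizations of a point with integral local ring lie in one relatively clopen set, [Stacks 01J7]).

HC_CM is proved only modulo the 7 printed citations until rung 0 closes; this file is a generic leaf and changes no count.

## References
* [Liu2021] Y. Liu, *Fourier–Jacobi cycles and arithmetic relative trace formula*, Camb. J. Math. 9 (2021), §2.1 Def. 2.1 (1) (FJcycle.tex l. 1171–1176).
* [SerreTate1968] J.-P. Serre, J. Tate, *Good reduction of abelian varieties*, Ann. of Math. 88 (1968), §1 (the reduction map).
* [Grothendieck1967] A. Grothendieck, EGA IV₄, Publ. Math. IHÉS 32 (1967), Prop. 17.5.8 (iii).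
-/

set_option autoImplicit false

noncomputable section

open CategoryTheory CategoryTheory.Limits AlgebraicGeometry MonoidalCategory IsDedekindDomain IsDedekindDomain.HeightOneSpectrum
open scoped NumberField
open Literature.AlgebraicGeometry.Motives

namespace Literature.NumberTheory.Automorphic.Liu2021.AppendixC

variable {F : Type} [Field F] [NumberField F] {w : HeightOneSpectrum (𝓞 F)} {X : SchemeOver F}

/-- **Two geometric points with the same reduction modulo a smooth proper model lie over a point of `∇X`** — the closer of the F0P5a support letter
`SmoothProperModelSeparatesNabla`: for `𝒮` a smooth proper model of `X` at `w`, `N` a `∇`-datum of `X` and `p, p' ∈ X(Ω)` with `red_𝒮 p = red_𝒮 p'`,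
there is `z ∈ ∇X(Ω)` over `(p, p')`.  (`𝒮 ⊗ 𝒮` is a smooth proper model of `X ⊗ X` whose reduction map identifies `(p, p)` and `(p, p')`; `(p, p) = p ≫ ΔX`
lies in the open and closed `∇X`; reduction modulo a model with integral local rings separates clopen subschemes of the generic fibre.)
[cite: Liu2021, §2.1 Def. 2.1 (1) (l. 1171–1176)] [cite: SerreTate1968, §1] [cite: Grothendieck1967, Prop. 17.5.8 (iii) (PDF p. 69)] -/
theorem Nabla.exists_comp_incl_eq_lift_of_geomReductionMap_eq (N : Nabla X)
    (𝒮 : IntegralModel (valuationSubringAtPrime F w) F X) {d : ℕ} (h𝒮 : 𝒮.IsSmoothProper d)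
    (p p' : AlgPoints X (AlgebraicClosure (w.adicCompletion F)))
    (h : haveI : IsProper 𝒮.total.hom := h𝒮.2
      𝒮.geomReductionMap p = 𝒮.geomReductionMap p') :
    ∃ z : AlgPoints N.N (AlgebraicClosure (w.adicCompletion F)), z ≫ N.incl = CartesianMonoidalCategory.lift p p' := by
  haveI : IsProper 𝒮.total.hom := h𝒮.2
  haveI : IsOpenImmersion N.incl.left := N.isOpenImmersion_incl
  haveI : IsClosedImmersion N.incl.left := N.isClosedImmersion_incl
  have hT : (𝒮.tensor 𝒮).IsSmoothProper (d + d) := h𝒮.tensor h𝒮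
  have hred : (haveI := IntegralModel.isProper_tensor_total 𝒮 𝒮; (𝒮.tensor 𝒮).geomReductionMap (CartesianMonoidalCategory.lift p p)) =
      (haveI := IntegralModel.isProper_tensor_total 𝒮 𝒮; (𝒮.tensor 𝒮).geomReductionMap (CartesianMonoidalCategory.lift p p')) :=
    IntegralModel.geomReductionMap_tensor_eq_of_components 𝒮 𝒮 _ _
      (by rw [AlgPoints.map_apply, AlgPoints.map_apply, CartesianMonoidalCategory.lift_fst, CartesianMonoidalCategory.lift_fst])
      (by rw [AlgPoints.map_apply, AlgPoints.map_apply, CartesianMonoidalCategory.lift_snd, CartesianMonoidalCategory.lift_snd]; exact h)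
  exact (𝒮.tensor 𝒮).exists_comp_eq_of_geomReductionMap_eq_of_isSmoothProper hT N.incl _ _ hred (p ≫ N.diag)
    (by rw [Category.assoc, N.diag_incl, CartesianMonoidalCategory.comp_lift, Category.comp_id])

end Literature.NumberTheory.Automorphic.Liu2021.AppendixC

end
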